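import Mathlib.NumberTheory.NumberField.Basic
import Mathlib.RingTheory.Localization.AtPrime.Basic
import Mathlib.RingTheory.Ideal.Norm.AbsNorm
import Literature.Computability.AlgebraicComplexity.StandardFamilies
import Summits.ValiantsHypothesis.ValiantsHypothesis.Theorems.TwoAdicLadderTwoIntegralNormalisationDenominators

/-!
# TwoAdicLadder — crux `TwoIntegralNormalisation` (stmt-ValiantsHypothesis-5947), line `birth`,
# stub `stub_halfElim`: THE SCALED HALF — `2`-INTEGRAL CIRCUITS FOR `2^M · per_n` AT NO COST

Route `ValiantsHypothesis/TwoAdicLadder`, crux `TwoIntegralNormalisation`, registered line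
`Cruxes/TwoIntegralNormalisation/Lines/birth.lean`, load-bearing stub `stub_halfElim`:
"one exponent `d` such that `L_K(per_n) ≤ s` over a number field `K` gives
`L_{𝓞_(𝔭)}(per_n) ≤ (s + n + 2)^d` over the local ring at some prime `𝔭 ∋ 2` of some number field"
(elimination of division by `2` at polynomial cost — OPEN).

This file proves the SCALED form of the stub, unconditionally and with no loss at all:

* `exists_ringHom_localizationAtPrime_two` — for a number field `K` and a prime `𝔭 ∋ 2` of `𝓞 K`,
  the inclusion `ι : 𝓞_(𝔭) = Localization.AtPrime 𝔭 → K` is injective and every `c ∈ K` is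
  `ι s / 2^n` for some `s ∈ 𝓞_(𝔭)` (denominators away from `𝔭` are units of `𝓞_(𝔭)`; the
  `𝔭`-part of a denominator `y` divides `|N(y)| = 2^n · odd`).
* `exists_complexity_two_pow_mul_perPoly_le` — **for every `n`, `K`, `𝔭 ∋ 2` there is `M` with
  `L_{𝓞_(𝔭)}(2^M · per_n) ≤ L_K(per_n)`** (denominator clearing,
  `TwoAdicLadderTwoIntegralNormalisationDenominators.lean`).
* `exists_isPrime_two_mem` — every number field has a prime `𝔭 ∋ 2`;
* `scaledHalfElim` — the registered stub with its conclusion weakened from `per_n` to `2^M · per_n`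
  holds with `d = 1`, `K' = K`: all divisions by `2` of a number-field circuit for the permanent
  can be postponed to ONE exact division by a power of `2` at the output.

What remains open in `stub_halfElim` is exactly that last exact division (`2` is not a unit of
`𝓞_(𝔭)`): the `2`-adic analogue of de-bordering (`ε`-division) with carries. Honest framing:
`stub_halfElim`, the crux and VP ≠ VNP are NOT proved here.
-/

noncomputable section

open MvPolynomial

-- the summit and the problem share the name `ValiantsHypothesis` (D-0017 single-conjunct layout)
set_option linter.dupNamespace false

namespace Summit.ValiantsHypothesis.ValiantsHypothesis.Theorems.TwoAdicLadder.TwoIntegralNormalisation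

open NumberField Literature.Computability.AlgebraicComplexity

/-- **The local ring at a prime over `2` sees every element of `K` up to a power of `2`.** For a
number field `K` and a prime ideal `𝔭` of `𝓞 K` with `2 ∈ 𝔭`, the canonical map
`ι : Localization.AtPrime 𝔭 →+* K` is injective and every `c ∈ K` satisfies `ι s = 2^n · c` for
some `n` and some `s ∈ 𝓞_(𝔭)`: write `c = x / y` with `x, y ∈ 𝓞 K`, `y ≠ 0`; then `y ∣ N = |N(y)|`,
`N = 2^n · q` with `q` odd, `q ∉ 𝔭` (else `1 = q − 2r ∈ 𝔭`), and `2^n · c = x y' / q` with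
`y y' = N`. [folklore; Neukirch, *Algebraic Number Theory*, I §11] -/
theorem exists_ringHom_localizationAtPrime_two (K : Type) [Field K] [NumberField K]
    (P : Ideal (𝓞 K)) [P.IsPrime] (h2 : (2 : 𝓞 K) ∈ P) :
    ∃ ι : Localization.AtPrime P →+* K, Function.Injective ι ∧
      ∀ c : K, ∃ (n : ℕ) (s : Localization.AtPrime P), ι s = ι 2 ^ n * c := by
  classical
  -- the map `𝓞_(𝔭) → K`
  have hunit : ∀ s : P.primeCompl, IsUnit (algebraMap (𝓞 K) K s) := fun s => by
    rw [isUnit_iff_ne_zero]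
    intro h0
    apply s.2
    have : (s : 𝓞 K) = 0 := (IsFractionRing.injective (𝓞 K) K) (h0.trans (map_zero _).symm)
    rw [this]
    exact P.zero_mem
  letI : Algebra (Localization.AtPrime P) K :=
    (IsLocalization.lift (M := P.primeCompl) hunit).toAlgebra
  haveI : IsScalarTower (𝓞 K) (Localization.AtPrime P) K :=
    IsScalarTower.of_algebraMap_eq fun a => (IsLocalization.lift_eq hunit a).symm
  haveI : IsFractionRing (Localization.AtPrime P) K :=
    IsFractionRing.isFractionRing_of_isDomain_of_isLocalization P.primeCompl
      (Localization.AtPrime P) K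
  refine ⟨algebraMap (Localization.AtPrime P) K, IsFractionRing.injective _ _, fun c => ?_⟩
  -- `c = x / y`
  obtain ⟨x, y, hy, rfl⟩ := IsFractionRing.div_surjective (A := 𝓞 K) c
  have hy0 : y ≠ 0 := nonZeroDivisors.ne_zero hy
  -- `y ∣ N := absNorm (y)`, `N = 2^n * q`, `q` odd
  set d : ℕ := Ideal.absNorm (Ideal.span ({y} : Set (𝓞 K))) with hd
  have hd0 : d ≠ 0 := by
    rw [hd, Ne, Ideal.absNorm_eq_zero_iff, Ideal.span_singleton_eq_bot]
    exact hy0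
  have hdmem : (d : 𝓞 K) ∈ Ideal.span ({y} : Set (𝓞 K)) := Ideal.absNorm_mem _
  obtain ⟨y', hy'⟩ := Ideal.mem_span_singleton'.1 hdmem
  obtain ⟨n, q, hq, hdq⟩ := Nat.exists_eq_two_pow_mul_odd hd0
  -- `q ∉ 𝔭`
  have hqP : (q : 𝓞 K) ∉ P := by
    intro hqP
    obtain ⟨r, hr⟩ := hq
    have h1 : (1 : 𝓞 K) = (q : 𝓞 K) - 2 * (r : 𝓞 K) := by
      rw [hr]; push_cast; ring
    have hmem : (1 : 𝓞 K) ∈ P := by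
      rw [h1]
      exact P.sub_mem hqP (P.mul_mem_right _ h2)
    exact (Ideal.IsPrime.ne_top inferInstance) ((Ideal.eq_top_iff_one P).2 hmem)
  -- the witness `s = x y' / q`
  have hqP' : (q : 𝓞 K) ∈ P.primeCompl := hqP
  set s : Localization.AtPrime P :=
    IsLocalization.mk' (Localization.AtPrime P) (x * y') ⟨(q : 𝓞 K), hqP'⟩ with hs
  refine ⟨n, s, ?_⟩
  have hAK : ∀ a : 𝓞 K,
      algebraMap (Localization.AtPrime P) K (algebraMap (𝓞 K) (Localization.AtPrime P) a) =
        algebraMap (𝓞 K) K a :=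
    fun a => (IsScalarTower.algebraMap_apply (𝓞 K) (Localization.AtPrime P) K a).symm
  have hspec := IsLocalization.mk'_spec (Localization.AtPrime P) (x * y') ⟨(q : 𝓞 K), hqP'⟩
  have key : algebraMap (Localization.AtPrime P) K s * (q : K) =
      algebraMap (𝓞 K) K x * algebraMap (𝓞 K) K y' := by
    have := congrArg (algebraMap (Localization.AtPrime P) K) hspec
    rw [map_mul, map_mul, map_mul, hAK, hAK, hAK] at this
    simpa [hs] using this
  have hqK : (q : K) ≠ 0 := by
    have hq0 : q ≠ 0 := by rintro rfl; exact (Nat.not_odd_zero hq).elim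
    exact_mod_cast hq0
  have hyK : algebraMap (𝓞 K) K y ≠ 0 := fun h =>
    hy0 ((IsFractionRing.injective (𝓞 K) K) (h.trans (map_zero _).symm))
  have hdK : algebraMap (𝓞 K) K y' * algebraMap (𝓞 K) K y = (2 : K) ^ n * (q : K) := by
    rw [← map_mul, hy', map_natCast, hdq]
    push_cast
    ring
  rw [map_ofNat]
  rw [show algebraMap (Localization.AtPrime P) K s =
      algebraMap (𝓞 K) K x * algebraMap (𝓞 K) K y' / (q : K) by rw [eq_div_iff hqK, key]]
  rw [div_eq_iff hqK, mul_div_assoc', div_mul_eq_mul_div, eq_div_iff hyK]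
  linear_combination (algebraMap (𝓞 K) K x) * hdK

/-- **The scaled `1/2`-elimination: `2`-integral circuits for `2^M · per_n` at no cost.** For every
`n`, every number field `K` and every prime `𝔭 ∋ 2` of `𝓞 K` there is an exponent `M` with
`L_{𝓞_(𝔭)}(2^M · per_n) ≤ L_K(per_n)`: clear the denominators of an optimal `K`-circuit gate by
gate (`exists_complexity_C_pow_mul_le`). [folklore] -/
theorem exists_complexity_two_pow_mul_perPoly_le (n : ℕ) (K : Type) [Field K] [NumberField K]
    (P : Ideal (𝓞 K)) [P.IsPrime] (h2 : (2 : 𝓞 K) ∈ P) :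
    ∃ M : ℕ, complexity (C ((2 : Localization.AtPrime P) ^ M) *
        perPoly (Fin n) (Localization.AtPrime P)) ≤ complexity (perPoly (Fin n) K) := by
  obtain ⟨ι, hι, hden⟩ := exists_ringHom_localizationAtPrime_two K P h2
  obtain ⟨M, hM⟩ :=
    exists_complexity_C_pow_mul_le ι hι 2 hden (perPoly (Fin n) (Localization.AtPrime P))
  exact ⟨M, by rwa [map_perPoly] at hM⟩

/-- Every number field has a prime ideal of its ring of integers containing `2`
(`|N(2)| = 2^{[K:ℚ]} ≠ 1`, so `(2) ≠ 𝓞 K` lies in a maximal ideal). [folklore] -/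
theorem exists_isPrime_two_mem (K : Type) [Field K] [NumberField K] :
    ∃ P : Ideal (𝓞 K), P.IsPrime ∧ (2 : 𝓞 K) ∈ P := by
  have hne : Ideal.span ({2} : Set (𝓞 K)) ≠ ⊤ := by
    intro htop
    have h1 : Ideal.absNorm (Ideal.span ({2} : Set (𝓞 K))) = 1 := by
      rw [htop]; exact Ideal.absNorm_top
    rw [Ideal.absNorm_span_singleton, show (2 : 𝓞 K) = algebraMap ℤ (𝓞 K) 2 by simp,
      Algebra.norm_algebraMap, NumberField.RingOfIntegers.rank] at h1
    have hpos : 0 < Module.finrank ℚ K := Module.finrank_pos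
    rw [Int.natAbs_pow] at h1
    have : (2 : ℤ).natAbs ^ Module.finrank ℚ K ≥ 2 := by
      calc (2 : ℤ).natAbs ^ Module.finrank ℚ K ≥ (2 : ℤ).natAbs ^ 1 :=
            Nat.pow_le_pow_right (by decide) hpos
        _ = 2 := by simp
    omega
  obtain ⟨M, hM, hle⟩ := Ideal.exists_le_maximal _ hne
  exact ⟨M, hM.isPrime, hle (Ideal.subset_span (Set.mem_singleton _))⟩

/-- **`scaledHalfElim` — the registered stub `stub_halfElim` with conclusion `2^M · per_n` in place
of `per_n` holds with exponent `d = 1` and `K' = K`.** For all `n s` and every number field `K`: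
if `L_K(per_n) ≤ s` then for some prime `𝔭 ∋ 2` of `𝓞 K` and some `M`,
`L_{𝓞_(𝔭)}(2^M · per_n) ≤ s`. The open content of `stub_halfElim` is the removal of the factor
`2^M` (one exact division by a power of `2` over a ring in which `2` is not a unit). [folklore] -/
theorem scaledHalfElim (n s : ℕ) (K : Type) [Field K] [NumberField K]
    (hs : complexity (perPoly (Fin n) K) ≤ s) :
    ∃ (K' : Type) (_ : Field K') (_ : NumberField K') (P : Ideal (𝓞 K')) (_ : P.IsPrime),
      (2 : 𝓞 K') ∈ P ∧ ∃ M : ℕ,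
        complexity (C ((2 : Localization.AtPrime P) ^ M) *
          perPoly (Fin n) (Localization.AtPrime P)) ≤ s := by
  obtain ⟨P, hP, h2⟩ := exists_isPrime_two_mem K
  obtain ⟨M, hM⟩ := exists_complexity_two_pow_mul_perPoly_le n K P h2
  refine ⟨K, inferInstance, inferInstance, P, hP, h2, M, ?_⟩
  exact hM.trans hs

end Summit.ValiantsHypothesis.ValiantsHypothesis.Theorems.TwoAdicLadder.TwoIntegralNormalisation

end
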